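import Literature.AlgebraicGeometry.Motives.HodgeLieMultiplicities
import HarnessLib

/-!
# Multiplicities do not change the centre or the derived algebra of the Hodge Lie algebra:
# `dim 𝔷(⊕_{(i,k)} H_i) = dim 𝔷(⊕_i H_i)`, `dim [𝔥, 𝔥](⊕_{(i,k)} H_i) = dim [𝔥, 𝔥](⊕_i H_i)`

Family `hodge`, layer `Literature/AlgebraicGeometry/Motives`; THEOREMS ONLY (no definition, no named fact; net debt 0).
Written for the cell `pub-hodgecm2` (COR-CM), seat `b27` gen 43 (count-neutral Mumford–Tate-rank ladder).  Sequel of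
`Motives/HodgeLieMultiplicities` (`dim 𝔥(⊕_{(i,k)} H_i) = dim 𝔥(⊕_i H_i)`): the two comparison maps used there — the compression
`X ↦ π X ι` to one coordinate per `i` and the fibrewise diagonal `Y ↦ Δ(Y)` — are MULTIPLICATIVE on the (block-diagonal) Hodge
Lie algebras and preserve Hodge endomorphisms, so they also match the centres `𝔷 = 𝔥 ∩ End_Hdg` and the derived algebras
`𝔡 = span {XY − YX}`.  For complex abelian varieties (`Hg(∏ B_i^{n_i}) = Hg(∏ B_i)` acting diagonally, Moonen–Zarhin 1999 §1):
the type-IV (central) part and the semisimple part of the Hodge group depend only on the SET of factors.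

* §1 block calculus for `X ∈ 𝔥(⊕_j G_j)`: `(X w)_j = X_{jj} (w_j)` (`apply_eq_block_apply_of_mem_hodgeLie_pi`).
* §2 the compression (`≤`): **`finrank_hodgeLie_inf_endAlg_and_derived_pi_sigma_le`**; §3 the fibrewise diagonal (`≥`):
  **`finrank_hodgeLie_inf_endAlg_and_derived_pi_le_sigma`**.
* §4 **`finrank_hodgeLie_inf_endAlg_pi_sigma_eq`**, **`finrank_hodgeLie_derived_pi_sigma_eq`**.

## References
* [MoonenZarhin1999LowDim] B. Moonen, Yu. Zarhin, Math. Ann. 315 (1999), §1 and §3 (3.1) [corpus: paper:arxiv-math_9901113 pp. 2, 6].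
  [cite: MoonenZarhin1999LowDim, §1 and §3]
* [Moonen1999MTNotes] B. Moonen, *Notes on Mumford–Tate groups* (1999), (1.8). [cite: Moonen1999MTNotes, (1.8)]
* [Deligne1982HodgeCycles] P. Deligne, LNM 900 (1982), I §3.1, Prop. 3.4 and Prop. 3.6. [cite: Deligne1982HodgeCycles, I §3 Prop. 3.6]
* [Huybrechts2016K3] D. Huybrechts, *Lectures on K3 Surfaces*, §3.3.3 (`End_Hdg`). [cite: Huybrechts2016K3, §3.3.3]
-/

noncomputable section

namespace Literature.AlgebraicGeometry.Motives

namespace HodgeStructure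

universe u

/-! ### §1 Block-diagonal action -/

section Blocks

variable {J : Type} [Fintype J] [DecidableEq J] {V : J → Type u} [∀ j, AddCommGroup (V j)] [∀ j, Module ℚ (V j)]
  [∀ j, Module.Finite ℚ (V j)] [HodgeTensorFacts.{u, u}] {n : ℤ} (G : ∀ j, HodgeStructure (V j) n)

/-- **`(X w)_j = X_{jj} (w_j)` for `X ∈ 𝔥(⊕_j G_j)`** (`X_{jj} = proj_j X single_j`; the off-diagonal blocks vanish,
`proj_comp_single_eq_zero_of_mem_hodgeLie_pi`). [cite: Deligne1982HodgeCycles, I §3 Prop. 3.6] [cite: MoonenZarhin1999LowDim, §1 and §3] -/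
theorem apply_eq_block_apply_of_mem_hodgeLie_pi {X : Module.End ℚ (∀ j, V j)} (hX : X ∈ (pi G).hodgeLie)
    (w : ∀ j, V j) (j : J) :
    (X w) j = (LinearMap.proj j ∘ₗ X ∘ₗ LinearMap.single ℚ V j) (w j) := by
  conv_lhs => rw [← Finset.univ_sum_single w]
  rw [map_sum, Finset.sum_apply, Finset.sum_eq_single j]
  · rfl
  · intro j' _ hj'
    have := LinearMap.congr_fun (proj_comp_single_eq_zero_of_mem_hodgeLie_pi G (Ne.symm hj') hX) (w j')
    simpa only [LinearMap.comp_apply, LinearMap.coe_single, LinearMap.proj_apply, LinearMap.zero_apply] using this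
  · intro h; exact absurd (Finset.mem_univ _) h

/-- **Blocks multiply: `(X Y)_{jj} = X_{jj} Y_{jj}`** for `Y ∈ 𝔥(⊕_j G_j)`. [cite: Deligne1982HodgeCycles, I §3 Prop. 3.6]
[cite: MoonenZarhin1999LowDim, §1 and §3] -/
theorem block_mul_of_mem_hodgeLie_pi (X : Module.End ℚ (∀ j, V j)) {Y : Module.End ℚ (∀ j, V j)}
    (hY : Y ∈ (pi G).hodgeLie) (j : J) :
    LinearMap.proj j ∘ₗ (X * Y) ∘ₗ LinearMap.single ℚ V j =
      (LinearMap.proj j ∘ₗ X ∘ₗ LinearMap.single ℚ V j) * (LinearMap.proj j ∘ₗ Y ∘ₗ LinearMap.single ℚ V j) := by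
  refine LinearMap.ext fun u => ?_
  have hYs : Y (Pi.single j u) = Pi.single j ((Y (Pi.single j u)) j) := by
    funext i
    by_cases h : i = j
    · subst h; rw [Pi.single_eq_same]
    · rw [Pi.single_eq_of_ne h]
      have := LinearMap.congr_fun (proj_comp_single_eq_zero_of_mem_hodgeLie_pi G h hY) u
      simpa only [LinearMap.comp_apply, LinearMap.coe_single, LinearMap.proj_apply, LinearMap.zero_apply] using this
  simp only [LinearMap.comp_apply, Module.End.mul_apply, LinearMap.coe_single, LinearMap.proj_apply]
  conv_lhs => rw [hYs]

omit [∀ j, Module.Finite ℚ (V j)] [HodgeTensorFacts.{u, u}] in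
/-- A diagonal block of a Hodge endomorphism of `⊕_j G_j` is a Hodge endomorphism of `G_j`. [cite: Huybrechts2016K3, §3.3.3] -/
theorem block_mem_endAlg_pi (j : J) {a : Module.End ℚ (∀ i, V i)} (ha : a ∈ (pi G).endAlg) :
    LinearMap.proj j ∘ₗ a ∘ₗ LinearMap.single ℚ V j ∈ (G j).endAlg :=
  Hom.toLinearMap_mem_endAlg ((Hom.piProj G j).comp ((endAlg.toHom ⟨a, ha⟩).comp (Hom.piSingle G j)))

end Blocks

/-! ### §2–§4 Multiplicities -/

section Sigma

variable {ι : Type} [Fintype ι] [DecidableEq ι] {m : ι → Type} [∀ i, Fintype (m i)] [∀ i, DecidableEq (m i)]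
  {W : ι → Type u} [∀ i, AddCommGroup (W i)] [∀ i, Module ℚ (W i)] [∀ i, Module.Finite ℚ (W i)]
  [HodgeTensorFacts.{u, u}] {n : ℤ} (H : ∀ i, HodgeStructure (W i) n)

/-- **`dim_ℚ 𝔷(⊕_{(i,k)} H_i) ≤ dim_ℚ 𝔷(⊕_i H_i)` and `dim_ℚ [𝔥,𝔥](⊕_{(i,k)} H_i) ≤ dim_ℚ [𝔥,𝔥](⊕_i H_i)`** (fibres nonempty): the
compression `X ↦ π X ι` (`ι(v)_{(i,k)} = v_i`, `π(w)_i = w_{(i,k₀ i)}`) preserves Hodge endomorphisms, is multiplicative on the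
block-diagonal `𝔥(⊕_{(i,k)} H_i)` (so maps commutators to commutators), and is injective on `𝔥(⊕_{(i,k)} H_i)`.
[cite: MoonenZarhin1999LowDim, §1 and §3] [cite: Moonen1999MTNotes, (1.8)] -/
theorem finrank_hodgeLie_inf_endAlg_and_derived_pi_sigma_le [∀ i, Nonempty (m i)] :
    Module.finrank ℚ ↥((pi fun p : Σ i, m i => H p.1).hodgeLie ⊓
        Subalgebra.toSubmodule (pi fun p : Σ i, m i => H p.1).endAlg) ≤
      Module.finrank ℚ ↥((pi H).hodgeLie ⊓ Subalgebra.toSubmodule (pi H).endAlg) ∧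
    Module.finrank ℚ ↥(Submodule.span ℚ {B | ∃ X ∈ (pi fun p : Σ i, m i => H p.1).hodgeLie,
        ∃ Y ∈ (pi fun p : Σ i, m i => H p.1).hodgeLie, X * Y - Y * X = B}) ≤
      Module.finrank ℚ ↥(Submodule.span ℚ {B | ∃ X ∈ (pi H).hodgeLie, ∃ Y ∈ (pi H).hodgeLie, X * Y - Y * X = B}) := by
  classical
  let k₀ : ∀ i, m i := fun i => Classical.arbitrary (m i)
  let G : ∀ p : Σ i, m i, HodgeStructure (W p.1) n := fun p => H p.1
  let ιH : Hom (pi H) (pi G) := Hom.piLift fun p => Hom.piProj H p.1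
  let πH : Hom (pi G) (pi H) := Hom.piLift fun i => Hom.piProj G ⟨i, k₀ i⟩
  have hπι : ∀ v, πH.toLinearMap (ιH.toLinearMap v) = v := fun v => by funext i; rfl
  -- the compression as a linear map `End(⊕_{(i,k)} W) → End(⊕_i W)`
  let r : Module.End ℚ (∀ p : Σ i, m i, W p.1) →ₗ[ℚ] Module.End ℚ (∀ i, W i) :=
    (LinearMap.llcomp ℚ _ _ _ πH.toLinearMap).comp (LinearMap.lcomp ℚ _ ιH.toLinearMap)
  have hr : ∀ X, r X = πH.toLinearMap ∘ₗ X ∘ₗ ιH.toLinearMap := fun _ => rfl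
  -- (a) `r` maps `𝔥(⊕G)` into `𝔥(⊕H)` and Hodge endomorphisms to Hodge endomorphisms
  have hr𝔥 : ∀ {X}, X ∈ (pi G).hodgeLie → r X ∈ (pi H).hodgeLie := fun hX => by
    rw [hr]; exact comp_mem_hodgeLie_of_retract ιH πH hπι hX
  have hrE : ∀ {X}, X ∈ (pi G).endAlg → r X ∈ (pi H).endAlg := fun {X} hX => by
    rw [hr]; exact Hom.toLinearMap_mem_endAlg (πH.comp ((endAlg.toHom ⟨X, hX⟩).comp ιH))
  -- (b) the block of `r X` at `i` is the block of `X` at `(i, k₀ i)`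
  have hblock : ∀ {X}, X ∈ (pi G).hodgeLie → ∀ i,
      LinearMap.proj i ∘ₗ r X ∘ₗ LinearMap.single ℚ W i =
        LinearMap.proj (⟨i, k₀ i⟩ : Σ i, m i) ∘ₗ X ∘ₗ LinearMap.single ℚ (fun p : Σ i, m i => W p.1) ⟨i, k₀ i⟩ := by
    intro X hX i
    refine LinearMap.ext fun u => ?_
    have hιu : ιH.toLinearMap (Pi.single i u) ⟨i, k₀ i⟩ = u := by
      change (Pi.single i u : ∀ j, W j) i = u
      rw [Pi.single_eq_same]
    change (X (ιH.toLinearMap (Pi.single i u))) ⟨i, k₀ i⟩ = (X (Pi.single (⟨i, k₀ i⟩ : Σ i, m i) u)) ⟨i, k₀ i⟩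
    rw [apply_eq_block_apply_of_mem_hodgeLie_pi G hX, apply_eq_block_apply_of_mem_hodgeLie_pi G hX, hιu]
    simp only [Pi.single_eq_same]
  -- (c) `r` is injective on `𝔥(⊕G)`
  have hrinj : ∀ {X}, X ∈ (pi G).hodgeLie → r X = 0 → X = 0 := by
    intro X hX h0
    refine eq_zero_of_forall_proj_comp_single_eq_zero G hX fun p => ?_
    obtain ⟨i, k⟩ := p
    have h := hblock hX i
    rw [h0, LinearMap.zero_comp, LinearMap.comp_zero] at h
    change LinearMap.proj (⟨i, k⟩ : Σ i, m i) ∘ₗ X ∘ₗ LinearMap.single ℚ (fun p : Σ i, m i => W p.1) ⟨i, k⟩ = 0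
    rw [proj_comp_single_eq_of_mem_hodgeLie_pi_sigma H hX i k (k₀ i), ← h]
  -- (d) `r` is multiplicative on `𝔥(⊕G)`
  have hrmul : ∀ {X Y}, X ∈ (pi G).hodgeLie → Y ∈ (pi G).hodgeLie → r (X * Y) = r X * r Y := by
    intro X Y hX hY
    refine LinearMap.ext fun v => funext fun i => ?_
    change (X (Y (ιH.toLinearMap v))) ⟨i, k₀ i⟩ = (X (ιH.toLinearMap (πH.toLinearMap (Y (ιH.toLinearMap v))))) ⟨i, k₀ i⟩
    rw [apply_eq_block_apply_of_mem_hodgeLie_pi G hX (Y (ιH.toLinearMap v)),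
      apply_eq_block_apply_of_mem_hodgeLie_pi G hX (ιH.toLinearMap _)]
    rfl
  refine ⟨?_, ?_⟩
  · -- centre
    let Φ : ↥((pi G).hodgeLie ⊓ Subalgebra.toSubmodule (pi G).endAlg) →ₗ[ℚ]
        ↥((pi H).hodgeLie ⊓ Subalgebra.toSubmodule (pi H).endAlg) :=
      { toFun := fun X => ⟨r X, Submodule.mem_inf.2 ⟨hr𝔥 (Submodule.mem_inf.1 X.2).1,
          (Subalgebra.mem_toSubmodule _).2 (hrE ((Subalgebra.mem_toSubmodule _).1 (Submodule.mem_inf.1 X.2).2))⟩⟩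
        map_add' := fun X Y => Subtype.ext (by simp only [Submodule.coe_add, map_add])
        map_smul' := fun c X => Subtype.ext (by simp only [Submodule.coe_smul, map_smul, RingHom.id_apply]) }
    have hΦ : Function.Injective Φ := by
      rw [injective_iff_map_eq_zero]
      intro X hX0
      exact Subtype.ext (hrinj (Submodule.mem_inf.1 X.2).1 (congrArg (fun Y : ↥((pi H).hodgeLie ⊓
        Subalgebra.toSubmodule (pi H).endAlg) => (Y : Module.End ℚ (∀ i, W i))) hX0))
    exact LinearMap.finrank_le_finrank_of_injective hΦ
  · -- derived algebra
    have hDle : Submodule.span ℚ {B | ∃ X ∈ (pi G).hodgeLie, ∃ Y ∈ (pi G).hodgeLie, X * Y - Y * X = B} ≤ (pi G).hodgeLie :=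
      Submodule.span_le.2 (by rintro _ ⟨X, hX, Y, hY, rfl⟩; exact (pi G).commutator_mem_hodgeLie hX hY)
    have hmap : (Submodule.span ℚ {B | ∃ X ∈ (pi G).hodgeLie, ∃ Y ∈ (pi G).hodgeLie, X * Y - Y * X = B}).map r ≤
        Submodule.span ℚ {B | ∃ X ∈ (pi H).hodgeLie, ∃ Y ∈ (pi H).hodgeLie, X * Y - Y * X = B} := by
      rw [Submodule.map_span, Submodule.span_le]
      rintro _ ⟨_, ⟨X, hX, Y, hY, rfl⟩, rfl⟩
      refine Submodule.subset_span ⟨r X, hr𝔥 hX, r Y, hr𝔥 hY, ?_⟩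
      rw [map_sub, hrmul hX hY, hrmul hY hX]
    let Ψ : ↥(Submodule.span ℚ {B | ∃ X ∈ (pi G).hodgeLie, ∃ Y ∈ (pi G).hodgeLie, X * Y - Y * X = B}) →ₗ[ℚ]
        ↥(Submodule.span ℚ {B | ∃ X ∈ (pi H).hodgeLie, ∃ Y ∈ (pi H).hodgeLie, X * Y - Y * X = B}) :=
      { toFun := fun D => ⟨r D, hmap ⟨D, D.2, rfl⟩⟩
        map_add' := fun D D' => Subtype.ext (by simp only [Submodule.coe_add, map_add])
        map_smul' := fun c D => Subtype.ext (by simp only [Submodule.coe_smul, map_smul, RingHom.id_apply]) }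
    have hΨ : Function.Injective Ψ := by
      rw [injective_iff_map_eq_zero]
      intro D hD0
      exact Subtype.ext (hrinj (hDle D.2) (congrArg (fun Y : ↥(Submodule.span ℚ {B | ∃ X ∈ (pi H).hodgeLie,
        ∃ Y ∈ (pi H).hodgeLie, X * Y - Y * X = B}) => (Y : Module.End ℚ (∀ i, W i))) hD0))
    exact LinearMap.finrank_le_finrank_of_injective hΨ

/-- **`dim_ℚ 𝔷(⊕_i H_i) ≤ dim_ℚ 𝔷(⊕_{(i,k)} H_i)` and `dim_ℚ [𝔥,𝔥](⊕_i H_i) ≤ dim_ℚ [𝔥,𝔥](⊕_{(i,k)} H_i)`** (fibres nonempty): the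
fibrewise diagonal `Δ(Y) = Σ_{(i,k)} single_{(i,k)} Y_{ii} proj_{(i,k)}` preserves Hodge endomorphisms, is multiplicative on the
block-diagonal `𝔥(⊕_i H_i)`, lands in `𝔥(⊕_{(i,k)} H_i)` (`fibreDiagonal_mem_hodgeLie_pi_sigma`) and is injective.
[cite: MoonenZarhin1999LowDim, §1 and §3] [cite: Moonen1999MTNotes, (1.8)] -/
theorem finrank_hodgeLie_inf_endAlg_and_derived_pi_le_sigma [∀ i, Nonempty (m i)] :
    Module.finrank ℚ ↥((pi H).hodgeLie ⊓ Subalgebra.toSubmodule (pi H).endAlg) ≤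
      Module.finrank ℚ ↥((pi fun p : Σ i, m i => H p.1).hodgeLie ⊓
        Subalgebra.toSubmodule (pi fun p : Σ i, m i => H p.1).endAlg) ∧
    Module.finrank ℚ ↥(Submodule.span ℚ {B | ∃ X ∈ (pi H).hodgeLie, ∃ Y ∈ (pi H).hodgeLie, X * Y - Y * X = B}) ≤
      Module.finrank ℚ ↥(Submodule.span ℚ {B | ∃ X ∈ (pi fun p : Σ i, m i => H p.1).hodgeLie,
        ∃ Y ∈ (pi fun p : Σ i, m i => H p.1).hodgeLie, X * Y - Y * X = B}) := by
  classical
  let k₀ : ∀ i, m i := fun i => Classical.arbitrary (m i)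
  let G : ∀ p : Σ i, m i, HodgeStructure (W p.1) n := fun p => H p.1
  let Δ₀ : Module.End ℚ (∀ i, W i) →ₗ[ℚ] Module.End ℚ (∀ p : Σ i, m i, W p.1) :=
    { toFun := fun Y => ∑ p : Σ i, m i, LinearMap.single ℚ (fun p : Σ i, m i => W p.1) p ∘ₗ
          (LinearMap.proj p.1 ∘ₗ Y ∘ₗ LinearMap.single ℚ W p.1) ∘ₗ LinearMap.proj p
      map_add' := fun Y Z => by
        simp only [LinearMap.comp_add, LinearMap.add_comp, Finset.sum_add_distrib]
      map_smul' := fun c Y => by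
        simp only [LinearMap.comp_smul, LinearMap.smul_comp, RingHom.id_apply, Finset.smul_sum] }
  have hΔ₀ : ∀ Y, Δ₀ Y = ∑ p : Σ i, m i, LinearMap.single ℚ (fun p : Σ i, m i => W p.1) p ∘ₗ
      (LinearMap.proj p.1 ∘ₗ Y ∘ₗ LinearMap.single ℚ W p.1) ∘ₗ LinearMap.proj p := fun _ => rfl
  -- (a) into `𝔥(⊕G)` and into `End_Hdg(⊕G)`
  have hΔ𝔥 : ∀ {Y}, Y ∈ (pi H).hodgeLie → Δ₀ Y ∈ (pi G).hodgeLie := fun hY => by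
    rw [hΔ₀]; exact fibreDiagonal_mem_hodgeLie_pi_sigma H hY
  have hΔE : ∀ {Y}, Y ∈ (pi H).endAlg → Δ₀ Y ∈ (pi G).endAlg := fun {Y} hY => by
    rw [hΔ₀]
    refine Subalgebra.sum_mem _ fun p _ => ?_
    exact Hom.toLinearMap_mem_endAlg ((Hom.piSingle G p).comp
      ((endAlg.toHom ⟨_, block_mem_endAlg_pi H p.1 hY⟩).comp (Hom.piProj G p)))
  -- (b) blocks of `Δ₀ Y`
  have hblock : ∀ (Y : Module.End ℚ (∀ i, W i)) (p : Σ i, m i),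
      LinearMap.proj p ∘ₗ Δ₀ Y ∘ₗ LinearMap.single ℚ (fun p : Σ i, m i => W p.1) p =
        LinearMap.proj p.1 ∘ₗ Y ∘ₗ LinearMap.single ℚ W p.1 := by
    intro Y p
    refine LinearMap.ext fun u => ?_
    rw [LinearMap.comp_apply, LinearMap.comp_apply, hΔ₀, LinearMap.sum_apply, map_sum, Finset.sum_eq_single p]
    · simp only [LinearMap.comp_apply, LinearMap.coe_single, LinearMap.proj_apply, Pi.single_eq_same]
    · intro p' _ hp'
      simp only [LinearMap.comp_apply, LinearMap.coe_single, LinearMap.proj_apply,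
        Pi.single_eq_of_ne (Ne.symm hp').symm, map_zero]
    · intro h; exact absurd (Finset.mem_univ _) h
  -- (c) injectivity on block-diagonal `Y`
  have hΔinj : ∀ {Y}, Y ∈ (pi H).hodgeLie → Δ₀ Y = 0 → Y = 0 := by
    intro Y hY h0
    refine eq_zero_of_forall_proj_comp_single_eq_zero H hY fun i => ?_
    rw [← hblock Y ⟨i, k₀ i⟩, h0]
    simp only [LinearMap.zero_comp, LinearMap.comp_zero]
  -- (d) multiplicativity: `Δ(Y Y') = Δ(Y) Δ(Y')` for block-diagonal `Y'`
  have hΔmul : ∀ (Y : Module.End ℚ (∀ i, W i)) {Y' : Module.End ℚ (∀ i, W i)}, Y' ∈ (pi H).hodgeLie →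
      Δ₀ (Y * Y') = Δ₀ Y * Δ₀ Y' := by
    intro Y Y' hY'
    rw [hΔ₀, hΔ₀, hΔ₀, Finset.sum_mul]
    refine Finset.sum_congr rfl fun p _ => ?_
    rw [block_mul_of_mem_hodgeLie_pi H Y hY' p.1, Finset.mul_sum, Finset.sum_eq_single p]
    · refine LinearMap.ext fun w => ?_
      simp only [Module.End.mul_apply, LinearMap.comp_apply, LinearMap.coe_single, LinearMap.proj_apply,
        Pi.single_eq_same]
    · intro p' _ hp'
      refine LinearMap.ext fun w => ?_
      simp only [Module.End.mul_apply, LinearMap.comp_apply, LinearMap.coe_single, LinearMap.proj_apply,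
        Pi.single_eq_of_ne (Ne.symm hp'), map_zero, LinearMap.zero_apply]
    · intro h; exact absurd (Finset.mem_univ _) h
  refine ⟨?_, ?_⟩
  · -- centre
    let Φ : ↥((pi H).hodgeLie ⊓ Subalgebra.toSubmodule (pi H).endAlg) →ₗ[ℚ]
        ↥((pi G).hodgeLie ⊓ Subalgebra.toSubmodule (pi G).endAlg) :=
      { toFun := fun Y => ⟨Δ₀ Y, Submodule.mem_inf.2 ⟨hΔ𝔥 (Submodule.mem_inf.1 Y.2).1,
          (Subalgebra.mem_toSubmodule _).2 (hΔE ((Subalgebra.mem_toSubmodule _).1 (Submodule.mem_inf.1 Y.2).2))⟩⟩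
        map_add' := fun X Y => Subtype.ext (by simp only [Submodule.coe_add, map_add])
        map_smul' := fun c X => Subtype.ext (by simp only [Submodule.coe_smul, map_smul, RingHom.id_apply]) }
    have hΦ : Function.Injective Φ := by
      rw [injective_iff_map_eq_zero]
      intro Y hY0
      exact Subtype.ext (hΔinj (Submodule.mem_inf.1 Y.2).1 (congrArg (fun X : ↥((pi G).hodgeLie ⊓
        Subalgebra.toSubmodule (pi G).endAlg) => (X : Module.End ℚ (∀ p : Σ i, m i, W p.1))) hY0))
    exact LinearMap.finrank_le_finrank_of_injective hΦ
  · -- derived algebra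
    have hDle : Submodule.span ℚ {B | ∃ X ∈ (pi H).hodgeLie, ∃ Y ∈ (pi H).hodgeLie, X * Y - Y * X = B} ≤ (pi H).hodgeLie :=
      Submodule.span_le.2 (by rintro _ ⟨X, hX, Y, hY, rfl⟩; exact (pi H).commutator_mem_hodgeLie hX hY)
    have hmap : (Submodule.span ℚ {B | ∃ X ∈ (pi H).hodgeLie, ∃ Y ∈ (pi H).hodgeLie, X * Y - Y * X = B}).map Δ₀ ≤
        Submodule.span ℚ {B | ∃ X ∈ (pi G).hodgeLie, ∃ Y ∈ (pi G).hodgeLie, X * Y - Y * X = B} := by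
      rw [Submodule.map_span, Submodule.span_le]
      rintro _ ⟨_, ⟨X, hX, Y, hY, rfl⟩, rfl⟩
      refine Submodule.subset_span ⟨Δ₀ X, hΔ𝔥 hX, Δ₀ Y, hΔ𝔥 hY, ?_⟩
      rw [map_sub, hΔmul X hY, hΔmul Y hX]
    let Ψ : ↥(Submodule.span ℚ {B | ∃ X ∈ (pi H).hodgeLie, ∃ Y ∈ (pi H).hodgeLie, X * Y - Y * X = B}) →ₗ[ℚ]
        ↥(Submodule.span ℚ {B | ∃ X ∈ (pi G).hodgeLie, ∃ Y ∈ (pi G).hodgeLie, X * Y - Y * X = B}) :=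
      { toFun := fun D => ⟨Δ₀ D, hmap ⟨D, D.2, rfl⟩⟩
        map_add' := fun D D' => Subtype.ext (by simp only [Submodule.coe_add, map_add])
        map_smul' := fun c D => Subtype.ext (by simp only [Submodule.coe_smul, map_smul, RingHom.id_apply]) }
    have hΨ : Function.Injective Ψ := by
      rw [injective_iff_map_eq_zero]
      intro D hD0
      exact Subtype.ext (hΔinj (hDle D.2) (congrArg (fun Y : ↥(Submodule.span ℚ {B | ∃ X ∈ (pi G).hodgeLie,
        ∃ Y ∈ (pi G).hodgeLie, X * Y - Y * X = B}) => (Y : Module.End ℚ (∀ p : Σ i, m i, W p.1))) hD0))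
    exact LinearMap.finrank_le_finrank_of_injective hΨ

/-- **Multiplicities do not change the centre of the Hodge Lie algebra: `dim_ℚ 𝔷(⊕_{(i,k)} H_i) = dim_ℚ 𝔷(⊕_i H_i)`**
(nonempty finite multiplicity sets). For abelian varieties: the type-IV part of `Hg(∏ B_i^{n_i})` is that of `Hg(∏ B_i)`.
[cite: MoonenZarhin1999LowDim, §1 and §3] [cite: Moonen1999MTNotes, (1.8)] -/
theorem finrank_hodgeLie_inf_endAlg_pi_sigma_eq [∀ i, Nonempty (m i)] :
    Module.finrank ℚ ↥((pi fun p : Σ i, m i => H p.1).hodgeLie ⊓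
        Subalgebra.toSubmodule (pi fun p : Σ i, m i => H p.1).endAlg) =
      Module.finrank ℚ ↥((pi H).hodgeLie ⊓ Subalgebra.toSubmodule (pi H).endAlg) :=
  le_antisymm (finrank_hodgeLie_inf_endAlg_and_derived_pi_sigma_le H).1
    (finrank_hodgeLie_inf_endAlg_and_derived_pi_le_sigma H).1

/-- **Multiplicities do not change the derived algebra of the Hodge Lie algebra:
`dim_ℚ [𝔥,𝔥](⊕_{(i,k)} H_i) = dim_ℚ [𝔥,𝔥](⊕_i H_i)`** (nonempty finite multiplicity sets). For abelian varieties: the semisimple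
part of `Hg(∏ B_i^{n_i})` is that of `Hg(∏ B_i)`. [cite: MoonenZarhin1999LowDim, §1 and §3] [cite: Moonen1999MTNotes, (1.8)] -/
theorem finrank_hodgeLie_derived_pi_sigma_eq [∀ i, Nonempty (m i)] :
    Module.finrank ℚ ↥(Submodule.span ℚ {B | ∃ X ∈ (pi fun p : Σ i, m i => H p.1).hodgeLie,
        ∃ Y ∈ (pi fun p : Σ i, m i => H p.1).hodgeLie, X * Y - Y * X = B}) =
      Module.finrank ℚ ↥(Submodule.span ℚ {B | ∃ X ∈ (pi H).hodgeLie, ∃ Y ∈ (pi H).hodgeLie, X * Y - Y * X = B}) :=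
  le_antisymm (finrank_hodgeLie_inf_endAlg_and_derived_pi_sigma_le H).2
    (finrank_hodgeLie_inf_endAlg_and_derived_pi_le_sigma H).2

end Sigma

end HodgeStructure

end Literature.AlgebraicGeometry.Motives

end
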